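import Literature.InformationTheory.QuantumCodes.CSSPhenomenologicalThreshold
import HarnessLib

/-!
# The deterministic fault-tolerance radius of `T` rounds of noisy syndrome measurement:
# minimum-weight space-time decoding corrects every `⌊(d-1)/2⌋` faults

Topic `Literature/InformationTheory/QuantumCodes` (venture QEC, LADDER-QEC rungs Q4/Q5 bridge; qec-lit-2 gen 3).
PROVED, theorem-only. The space-time code of `T` rounds of noisy measurement of one error type of a CSS code
(`CSSPhenomenologicalThreshold.lean`: histories `E`, boundary `stSyn H T`, cycles `stCycles H T`, harmless
histories `stTrivial SX T`; toric instance `ToricCodePhenomenological.lean`) has space-time distance `≥ d`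
(`CSSPhenom.le_hammingNorm_of_stCycle_not_trivial`: a closed history with non-trivial residual has `≥ d`
faults, `d` the distance of the error type). Hence the tree's general radius theorem for minimum-weight
decoding (`Decoder.IsMinWeight.correctsUpTo`: "a code with distance at least `2t+1` is able to correct
arbitrary errors on any `t` qubits") gives the DETERMINISTIC guarantee of the memory experiment: every
history with at most `t` faults IN TOTAL — data-qubit errors and wrong syndrome bits counted together, in
any rounds — is corrected by every minimum-weight space-time decoder as soon as `2t + 1 ≤ d`
(`CSSPhenom.correctsUpTo_of_isMinWeight`, `…_half`; toric code: `t = ⌊(L-1)/2⌋`,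
`ToricCode.st_correctsUpTo_of_isMinWeight`). This is the worst-case companion of the probabilistic
thresholds (`cssPhenomThreshold_of_rowWeight`, `ToricCode.phenomThreshold_cluster`).

## References

* [NielsenChuang2010] M. A. Nielsen, I. L. Chuang, *Quantum Computation and Quantum Information*, CUP 2010,
  §10.5.5 p. 467 (distance `2t+1` corrects `t` errors) — applied to the space-time code.
* [DennisEtAl2002] E. Dennis, A. Kitaev, A. Landahl, J. Preskill, J. Math. Phys. 43 (2002) 4452, §4.3
  (success iff `E + E'` homologically trivial), §5.2 (a non-trivial space-time cycle has `≥ L` links).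
-/

namespace Literature.InformationTheory.QuantumCodes

open Finset Matrix

/-- Hamming weight is subadditive on `𝔽₂`-vectors. [folklore] -/
private theorem hammingNorm_add_le'' {κ : Type*} [Fintype κ] (x y : κ → ZMod 2) :
    hammingNorm (x + y) ≤ hammingNorm x + hammingNorm y := by
  have hneg : ∀ z : κ → ZMod 2, -z = z := fun z => funext fun i => ZMod.neg_eq_self_mod_two (z i)
  have h := hammingDist_triangle x 0 (-y)
  rw [hammingDist_eq_hammingNorm, hammingDist_eq_hammingNorm, hammingDist_eq_hammingNorm,
    neg_zero, zero_add, add_zero, hneg, hneg] at h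
  simpa [sub_eq_add_neg, hneg] using h

namespace CSSPhenom

variable {ι V : Type*} [Fintype ι] [DecidableEq ι] [Fintype V] [DecidableEq V] {T : ℕ}
  {H : Matrix ι V (ZMod 2)}

/-- **`T` rounds of noisy measurement tolerate any `t` faults when `2t + 1 ≤ d`**: for one error type of
a CSS code with `d ≤` the weight of every element of `ker H ∖ SX`, every minimum-weight space-time decoder
corrects every error history with at most `t` faults in total (qubit errors and measurement errors, any
rounds): the residual `Π(E + D(∂E))` lies in `SX`.
[cite: NielsenChuang2010, §10.5.5 p. 467 (distance ≥ 2t+1 corrects t errors; here the space-time code)] -/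
theorem correctsUpTo_of_isMinWeight (SX : Submodule (ZMod 2) (V → ZMod 2)) {D : STDecoder ι V T}
    (hD : D.IsMinWeight (stSyn H T) (stCycles H T) hammingNorm) {d : ℕ}
    (hd : ∀ x : V → ZMod 2, H *ᵥ x = 0 → x ∉ SX → d ≤ hammingNorm x) {t : ℕ} (ht : 2 * t + 1 ≤ d) :
    D.CorrectsUpTo (stSyn H T) (stTrivial (SX : Set (V → ZMod 2)) T) hammingNorm t := by
  have hdist : ∀ x ∈ stCycles H T, x ∉ stTrivial (SX : Set (V → ZMod 2)) T → d ≤ hammingNorm x := by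
    intro x hx hxS
    have hxS' : x ∉ stTrivialSubmodule T SX := by
      intro h
      exact hxS (by rw [← coe_stTrivialSubmodule]; exact h)
    exact le_hammingNorm_of_stCycle_not_trivial hd hx hxS'
  exact hD.correctsUpTo hammingNorm_add_le'' hdist ht

/-- `⌊(d-1)/2⌋` form of the same guarantee (`0 < d`).
[cite: NielsenChuang2010, §10.5.5 p. 467 (here the space-time code)] -/
theorem correctsUpTo_half_of_isMinWeight (SX : Submodule (ZMod 2) (V → ZMod 2)) {D : STDecoder ι V T}
    (hD : D.IsMinWeight (stSyn H T) (stCycles H T) hammingNorm) {d : ℕ}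
    (hd : ∀ x : V → ZMod 2, H *ᵥ x = 0 → x ∉ SX → d ≤ hammingNorm x) (hd0 : 0 < d) :
    D.CorrectsUpTo (stSyn H T) (stTrivial (SX : Set (V → ZMod 2)) T) hammingNorm ((d - 1) / 2) :=
  correctsUpTo_of_isMinWeight SX hD hd (by omega)

omit [DecidableEq V] in
/-- Non-vacuity: the canonical minimum-weight space-time decoder is a minimum-weight decoder for
`stSyn` w.r.t. the space-time cycles. [cite: DennisEtAl2002, §5.1 eq. (E_min)] -/
theorem isMinWeight_minWeight (H : Matrix ι V (ZMod 2)) (T : ℕ) :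
    (Decoder.minWeight (stSyn H T) hammingNorm).IsMinWeight (stSyn H T) (stCycles H T) hammingNorm := by
  refine Decoder.isMinWeight_minWeight _ _ _ (fun y z h => ?_) (fun x => ?_)
  · show stMatrix H T *ᵥ (y - z) = 0
    rw [Matrix.mulVec_sub]
    change stSyn H T y - stSyn H T z = 0
    rw [h, sub_self]
  · rw [show -x = x from funext fun i => ZMod.neg_eq_self_mod_two (x i)]

end CSSPhenom

namespace ToricCode

variable {L T : ℕ} [NeZero L]

/-- **Toric code, `T` noisy rounds: every `⌊(L-1)/2⌋` faults are corrected** by every minimum-weight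
space-time decoder (qubit errors and wrong site-operator outcomes counted together, any rounds): the
residual `Π(E + D(∂E))` is a plaquette boundary. [cite: DennisEtAl2002, §5.2 (a homologically nontrivial path contains at least L links) with §4.3] -/
theorem st_correctsUpTo_of_isMinWeight (D : STDecoder L T)
    (hD : D.IsMinWeight (stSyn L T) (stCycles L T) hammingNorm) {t : ℕ} (ht : 2 * t + 1 ≤ L) :
    D.CorrectsUpTo (stSyn L T) (stTrivial L T) hammingNorm t := by
  have hdist : ∀ x ∈ stCycles L T, x ∉ stTrivial L T → L ≤ hammingNorm x := by
    intro x hx hxS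
    have hxS' : x ∉ stTrivialSubmodule L T := by
      intro h
      exact hxS (by rw [← coe_stTrivialSubmodule]; exact h)
    exact le_hammingNorm_of_stCycle_not_trivial hx hxS'
  exact hD.correctsUpTo hammingNorm_add_le'' hdist ht

/-- `⌊(L-1)/2⌋` form for the toric code. [cite: DennisEtAl2002, §5.2 with §4.3] -/
theorem st_correctsUpTo_half_of_isMinWeight (D : STDecoder L T)
    (hD : D.IsMinWeight (stSyn L T) (stCycles L T) hammingNorm) :
    D.CorrectsUpTo (stSyn L T) (stTrivial L T) hammingNorm ((L - 1) / 2) :=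
  st_correctsUpTo_of_isMinWeight D hD (by have := Nat.one_le_iff_ne_zero.2 (NeZero.ne L); omega)

end ToricCode

end Literature.InformationTheory.QuantumCodes
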